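import Literature.NumberTheory.EllipticCurves.ManinConstantModularDegree
import Literature.NumberTheory.EllipticCurves.ManinConstantQuadraticTwistGamma0Proofs
import Literature.NumberTheory.EllipticCurves.ModularDegreeQuadraticTwistProofs
import Literature.NumberTheory.EllipticCurves.ManinConstantQuadraticTwistCremonaRangeProofs
import Literature.NumberTheory.EllipticCurves.Isogeny
import Literature.NumberTheory.DiophantineGeometry.EllArithGlue
import Literature.NumberTheory.EllipticCurves.ComplexMultiplicationLFunctionIsogenyHoldsProofs
import Literature.NumberTheory.EllipticCurves.ModularCurveNeronLatticeProofs
import Literature.Barriers.ABC.BakerMethodBoundsPrincipalUnitsProofs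
import HarnessLib

/-!
# Twist-orbit transport of the Manin constant at an additive prime — THEOREMS A / II / III of cell
# `bsd-f2-manin` (analytic / period-lattice lens), kernel-checked

PROVENANCE. This file is the planner `bsd-f2-manin-an` g2/g3's HOME/an/Sketch-an4v5.lean (sha16
2d253c8874352f93 = Sketch-an4 f1ae90b1b6cd04c4 + §§5–8; farm rc 0 · 0 sorries · 0 warnings; referee-grade
paper proofs in HOME/an/PROOF-an.md, memo HOME/an/MEMO-an.md PART III–IV §§18–34), landed VERBATIM by the
cell's typer (ask T-an-6) with only the namespace changed (the sketch namespace ↦ the cell's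
`Summit.BirchSwinnertonDyer.Rank1Residual.ManinAdditive`) and this header added. CONTENT: parameterised
statements `TwistOrbitManinTransport d q M` (E-an-9 = THM A), `CommutingOrbitManinChain` (E-an-12c = THM III
chain), `OrbitDegreeManinIdentity` (S-an-13 = THM B, Watkins), `ManinEqOfNotDvdDegree` (E-an-16),
`TwistMinimalDegreeRoadTransport` / `TwistPartnerDegreeBound` (E-an-15 / 15v, modulo the printed
Česnavičius–Neururer–Saha Thm 1.2 = tree fact `cesnaviciusNeururerSaha_thm_1_2`, taken as an explicit
hypothesis), `FlipOrbitManinEq` (THM II), `OrbitManinDefectLeOne` (THM III, modulo `PalTwistDichotomy` =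
Pal 2012 Prop. 2.4–2.5 stated as an explicit hypothesis-Prop, NOT asserted), and their PROOFS at every odd
same-level orbit `(d, q, M) = (q*, q, q²)` and at `(−3, 3, 9)`, `(5, 5, 25)`, `(−7, 7, 49)`:
`twistOrbitManinTransport_pStar`, `commutingOrbitManinChain_pStar`, `orbitDegreeManinIdentity_pStar`,
`maninEqOfNotDvdDegree_pStar_holds`, `flipOrbitManinEq_pStar`, `orbitManinDefectLeOne_pStar`,
`twistMinimalDegreeRoadTransport_pStar` (given ČNS). Refuter status at landing: REF1 R-an-6 (Sketch-an3 =
the g2 statements) SURVIVE 2026-08-27T17:30Z (HOME/REFUTER-ref1.md §R9); R-an-7/8 (this file's g3 additions)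
pending — the additions are kernel-checked theorems, not conjectures; REF2 R-an-7 (17:47Z): E-an-15/15v/16/12c
NOT-IN-PRINT as statements, PRINT-COROLLARIES of E-an-9/12 with printed second factors (ČNS Thm 1.2/1.3;
Watkins 2002 §2.1 / Edixhoven 1991 §4 degree identity). Nothing in this file is a `@[conjecture]`; no `sorry`.

# FILE 1/3 — statement schemas, elementary edges, §6 partner bound, §8 statement schemas + edges.
# (the planner's original module header — census numbers, falsifier runs — is in HOME/an/Sketch-an4v5.lean and
# MEMO-an.md PART IV; omitted here for the 400-line limit)
-/

noncomputable section

open scoped MatrixGroups ModularForm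

open CongruenceSubgroup WeierstrassCurve
  Literature.NumberTheory.DiophantineGeometry
  Literature.NumberTheory.EllipticCurves
  Literature.NumberTheory.EllipticCurves.ModularForms

namespace Summit.BirchSwinnertonDyer.Rank1Residual.ManinAdditive

/-- `Λ_W = c · Λ_f` (lattice-optimality clause; verbatim from HOME/an/Sketch-an3.lean). -/
def IsLatticeOptimal {W : WeierstrassCurve ℚ} {N : ℕ} [NeZero N]
    (D : ModularParametrizationData W N) : Prop :=
  ∀ z ∈ D.L.lattice, ∃ w ∈ periodLattice D.f, z = D.c * w

/-- **E-an-9 `TwistOrbitManinTransport d q M` (THEOREM A; verbatim from HOME/an/Sketch-an3.lean, g2).** -/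
def TwistOrbitManinTransport (d : ℤ) (q M : ℕ) : Prop :=
  ∀ (W W' C : WeierstrassCurve ℚ) [W.IsElliptic] [W.IsGloballyMinimal] [W'.IsElliptic]
    [W'.IsGloballyMinimal] [C.IsElliptic] [C.IsGloballyMinimal]
    [NeZero (W.conductorNorm ℤ)] [NeZero (W'.conductorNorm ℤ)] (u : VariableChange ℚ)
    (D : ModularParametrizationData W (W.conductorNorm ℤ))
    (D' : ModularParametrizationData W' (W'.conductorNorm ℤ)),
    M ∣ W.conductorNorm ℤ → W'.conductorNorm ℤ = W.conductorNorm ℤ →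
    u • W.quadraticTwist ((d : ℤ) : ℚ) = C → WeierstrassCurve.IsIsogenous C W' →
    IsLatticeOptimal D' →
    (C.Δ = ((d : ℤ) : ℚ) ^ 6 * W.Δ → D'.c ∣ D.c) ∧
    ((q : ℚ) ^ 12 * C.Δ = ((d : ℤ) : ℚ) ^ 6 * W.Δ → D'.c ∣ (q : ℤ) * D.c)

/-- **E-an-15 `TwistMinimalDegreeRoadTransport d M` (CNS ∘ A; beyond print given E-an-9).** Same conductor
`N`, `M ∣ N`, `C` a globally minimal model of `W ⊗ χ_d` ISOGENOUS to `W'` (commuting or flip orbit alike),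
`Δ(C) = d⁶ Δ(W)` (`W` twist-minimal for `d`), `D` ANY parametrisation datum of `W` at level `N`, `D'` the
lattice-optimal datum of `W'`, `p` any prime: `p ∤ deg(D)` and `ε_p(N) = 0` (the printed ČNS correction,
`cesnaviciusNeururerSahaCorrection`) ⇒ `p ∤ c(D')`.  The gain is at `p = q` (the prime under `d`): there
`deg(D') = q·deg(D)` (E-an-16) so ČNS on `D'` alone gives only `v_q(c(D')) ≤ 1`.  Instances with data:
`(−3, 9)`: 12 414 orbits newly decided at 3; `(5, 25)`: 49 167; `(−7, 49)`: 34 739 (HOME/an/g3-cnsA_*.out). -/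
def TwistMinimalDegreeRoadTransport (d : ℤ) (M : ℕ) : Prop :=
  ∀ (W W' C : WeierstrassCurve ℚ) [W.IsElliptic] [W.IsGloballyMinimal] [W'.IsElliptic]
    [W'.IsGloballyMinimal] [C.IsElliptic] [C.IsGloballyMinimal]
    [NeZero (W.conductorNorm ℤ)] [NeZero (W'.conductorNorm ℤ)] (u : VariableChange ℚ)
    (D : ModularParametrizationData W (W.conductorNorm ℤ))
    (D' : ModularParametrizationData W' (W'.conductorNorm ℤ)) (p : ℕ), p.Prime →
    M ∣ W.conductorNorm ℤ → W'.conductorNorm ℤ = W.conductorNorm ℤ →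
    u • W.quadraticTwist ((d : ℤ) : ℚ) = C → WeierstrassCurve.IsIsogenous C W' →
    IsLatticeOptimal D' → C.Δ = ((d : ℤ) : ℚ) ^ 6 * W.Δ →
    ¬ p ∣ D.modularDegree → cesnaviciusNeururerSahaCorrection (W.conductorNorm ℤ) p = 0 →
    ¬ (p : ℤ) ∣ D'.c

/-- PROVED edge: E-an-9 (free direction) ∧ ČNS Thm 1.2 ⇒ E-an-15. -/
theorem twistMinimalDegreeRoadTransport_of_transport (d : ℤ) (q M : ℕ)
    (hT : TwistOrbitManinTransport d q M) (hCNS : cesnaviciusNeururerSaha_thm_1_2) :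
    TwistMinimalDegreeRoadTransport d M := by
  intro W W' C _ _ _ _ _ _ _ _ u D D' p hp hM hN hu hC hD' hΔ hdeg hε
  have h1 : D'.c ∣ D.c := (hT W W' C u D D' hM hN hu hC hD').1 hΔ
  have hle : padicValInt p D.maninConstant ≤ padicValNat p D.modularDegree := by
    have := hCNS W D p hp
    rwa [hε, add_zero] at this
  have h2 : ¬ (p : ℤ) ∣ D.c := not_dvd_maninConstant_of_padicVal_le_of_not_dvd D hp hle hdeg
  exact fun h3 ↦ h2 (h3.trans h1)

/-- **Kernel-checked core of E-an-16.** `c' ∣ c ∣ q·c'`, `deg'·c² = q·deg·c'²`, `q` prime, `q ∤ deg`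
⇒ `c' = ±c` and `deg' = q·deg`. [elementary] -/
theorem natAbs_eq_and_deg_eq_of_chain {q : ℕ} (hq : q.Prime) {c c' : ℤ} {deg deg' : ℕ}
    (hc' : c' ≠ 0) (h1 : c' ∣ c) (h2 : c ∣ (q : ℤ) * c')
    (hI : (deg' : ℤ) * c ^ 2 = (q : ℤ) * deg * c' ^ 2) (hdeg : ¬ q ∣ deg) :
    (c' = c ∨ c' = -c) ∧ deg' = q * deg := by
  obtain ⟨k, hk⟩ := h1
  -- `k ∣ q`
  have hkq : k ∣ (q : ℤ) := by
    obtain ⟨m, hm⟩ := h2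
    refine ⟨m, ?_⟩
    have hmc : (q : ℤ) * c' = c' * k * m := by rw [← hk]; exact hm
    have : c' * ((q : ℤ) - k * m) = 0 := by linear_combination hmc
    rcases mul_eq_zero.mp this with h0 | h0
    · exact absurd h0 hc'
    · linear_combination h0
  have hknat : k.natAbs ∣ q := by
    have := Int.natAbs_dvd_natAbs.mpr hkq
    simpa using this
  rcases (Nat.dvd_prime hq).mp hknat with h1' | hq'
  · -- `|k| = 1`
    have hk1 : k = 1 ∨ k = -1 := by
      rcases Int.natAbs_eq k with h | h <;> [left; right] <;> rw [h, h1'] <;> simp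
    have hk2 : k ^ 2 = 1 := by rcases hk1 with h | h <;> simp [h]
    have hcc : c = c' ∨ c = -c' := by
      rcases hk1 with h | h
      · left; rw [hk, h, mul_one]
      · right; rw [hk, h]; ring
    refine ⟨?_, ?_⟩
    · rcases hcc with h | h
      · left; rw [h]
      · right; rw [h]; ring
    · have hc2 : c ^ 2 = c' ^ 2 := by rw [hk]; ring_nf; rw [mul_comm, ← mul_pow] ; ring_nf; rw [hk2]; ring
      rw [hc2] at hI
      have hc'2 : c' ^ 2 ≠ 0 := pow_ne_zero 2 hc'
      have : (deg' : ℤ) = (q : ℤ) * deg := mul_right_cancel₀ hc'2 (by linarith)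
      exact_mod_cast this
  · -- `|k| = q`: then `q ∣ deg`, contradiction
    exfalso
    have hk2 : k ^ 2 = (q : ℤ) ^ 2 := by
      rw [← Int.natAbs_sq k, hq']
    have hI' : (deg' : ℤ) * (q : ℤ) ^ 2 * c' ^ 2 = (q : ℤ) * deg * c' ^ 2 := by
      linear_combination hI - (deg' : ℤ) * (c + c' * k) * hk - (deg' : ℤ) * c' ^ 2 * hk2
    have hc'2 : c' ^ 2 ≠ 0 := pow_ne_zero 2 hc'
    have hq0 : (q : ℤ) ≠ 0 := by exact_mod_cast hq.ne_zero
    have h3 : (deg' : ℤ) * (q : ℤ) ^ 2 = (q : ℤ) * deg := mul_right_cancel₀ hc'2 hI'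
    have h4 : (deg' : ℤ) * q = deg := by
      have : (q : ℤ) * ((deg' : ℤ) * q) = (q : ℤ) * deg := by linear_combination h3
      exact mul_left_cancel₀ hq0 this
    exact hdeg ⟨deg', by exact_mod_cast (by linear_combination -h4 : (deg : ℤ) = q * deg')⟩

/-- **E-an-12c `CommutingOrbitManinChain d q M`** (THM III restricted to commuting orbits with `W`
twist-minimal: `c' ∣ c ∣ q·c'`; = E-an-12 `OrbitManinDefectLeOne` with `C = W'`, PROVED there from
E-an-9 + S-an-11). -/
def CommutingOrbitManinChain (d : ℤ) (q M : ℕ) : Prop :=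
  ∀ (W W' : WeierstrassCurve ℚ) [W.IsElliptic] [W.IsGloballyMinimal] [W'.IsElliptic]
    [W'.IsGloballyMinimal] [NeZero (W.conductorNorm ℤ)] [NeZero (W'.conductorNorm ℤ)]
    (u : VariableChange ℚ) (D : ModularParametrizationData W (W.conductorNorm ℤ))
    (D' : ModularParametrizationData W' (W'.conductorNorm ℤ)),
    M ∣ W.conductorNorm ℤ → W'.conductorNorm ℤ = W.conductorNorm ℤ →
    u • W.quadraticTwist ((d : ℤ) : ℚ) = W' → IsLatticeOptimal D → IsLatticeOptimal D' →
    W'.Δ = ((d : ℤ) : ℚ) ^ 6 * W.Δ →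
    D'.c ∣ D.c ∧ D.c ∣ (q : ℤ) * D'.c

/-- **S-an-13 `OrbitDegreeManinIdentity d q M`** (THM B; verbatim from Sketch-an3; IN PRINT [Watkins 2002
§2.1] and in tree as `ModularParametrizationData.deg_mul_sq_mul_sq_eq_of_quadraticTwist_of_natAbs_eq`
modulo `|aₙ(W')| = |aₙ(W)|` and `u = ±1`). -/
def OrbitDegreeManinIdentity (d : ℤ) (q M : ℕ) : Prop :=
  ∀ (W W' : WeierstrassCurve ℚ) [W.IsElliptic] [W.IsGloballyMinimal] [W'.IsElliptic]
    [W'.IsGloballyMinimal] [NeZero (W.conductorNorm ℤ)] [NeZero (W'.conductorNorm ℤ)]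
    (u : VariableChange ℚ) (D : ModularParametrizationData W (W.conductorNorm ℤ))
    (D' : ModularParametrizationData W' (W'.conductorNorm ℤ)),
    M ∣ W.conductorNorm ℤ → W'.conductorNorm ℤ = W.conductorNorm ℤ →
    u • W.quadraticTwist ((d : ℤ) : ℚ) = W' → IsLatticeOptimal D → IsLatticeOptimal D' →
    W'.Δ = ((d : ℤ) : ℚ) ^ 6 * W.Δ →
    (D'.modularDegree : ℤ) * D.c ^ 2 = (q : ℤ) * D.modularDegree * D'.c ^ 2

/-- **E-an-16 `ManinEqOfNotDvdDegree d q M` (THEOREM given E-an-9/12 and THM B; beyond print).** On a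
COMMUTING same-level `χ_d`-orbit with `W` twist-minimal (`Δ(W') = d⁶Δ(W)`), if `q ∤ deg(D)` for the
lattice-optimal datum of `W` then the Manin constants AGREE up to sign and the degree grows by exactly `q`:
the conjecture-bit E-an-13 is decided on these orbits (p = 3: 12 414 of 141 917 commuting orbits at 9 ∣ N;
p = 5: 49 167 of 81 755; p = 7: 34 739 of 46 852; p = 11: 17 350 of 19 775; p = 13: 12 456 of 13 701). -/
def ManinEqOfNotDvdDegree (d : ℤ) (q M : ℕ) : Prop :=
  ∀ (W W' : WeierstrassCurve ℚ) [W.IsElliptic] [W.IsGloballyMinimal] [W'.IsElliptic]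
    [W'.IsGloballyMinimal] [NeZero (W.conductorNorm ℤ)] [NeZero (W'.conductorNorm ℤ)]
    (u : VariableChange ℚ) (D : ModularParametrizationData W (W.conductorNorm ℤ))
    (D' : ModularParametrizationData W' (W'.conductorNorm ℤ)),
    M ∣ W.conductorNorm ℤ → W'.conductorNorm ℤ = W.conductorNorm ℤ →
    u • W.quadraticTwist ((d : ℤ) : ℚ) = W' → IsLatticeOptimal D → IsLatticeOptimal D' →
    W'.Δ = ((d : ℤ) : ℚ) ^ 6 * W.Δ → ¬ q ∣ D.modularDegree →
    (D'.c = D.c ∨ D'.c = -D.c) ∧ D'.modularDegree = q * D.modularDegree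

/-- PROVED edge: E-an-12c ∧ S-an-13 ⇒ E-an-16 (`q` prime). -/
theorem maninEqOfNotDvdDegree_of_chain (d : ℤ) {q : ℕ} (M : ℕ) (hq : q.Prime)
    (hCh : CommutingOrbitManinChain d q M) (hI : OrbitDegreeManinIdentity d q M) :
    ManinEqOfNotDvdDegree d q M := by
  intro W W' _ _ _ _ _ _ u D D' hM hN hu hD hD' hΔ hdeg
  obtain ⟨h1, h2⟩ := hCh W W' u D D' hM hN hu hD hD' hΔ
  have hId := hI W W' u D D' hM hN hu hD hD' hΔ
  exact natAbs_eq_and_deg_eq_of_chain hq D'.maninConstant_ne_zero_holds h1 h2 hId hdeg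

/-- PROVED edge: on the same orbits E-an-15's conclusion also follows WITHOUT E-an-9's isogeny clause, for the
optimal data: E-an-16 ∧ ČNS ⇒ (`q ∤ deg D ∧ ε_q(N) = 0 ⇒ q ∤ c(D')`). -/
theorem not_dvd_c_of_maninEq_of_cns (d : ℤ) {q : ℕ} (M : ℕ) (hq : q.Prime)
    (hE : ManinEqOfNotDvdDegree d q M) (hCNS : cesnaviciusNeururerSaha_thm_1_2)
    (W W' : WeierstrassCurve ℚ) [W.IsElliptic] [W.IsGloballyMinimal] [W'.IsElliptic]
    [W'.IsGloballyMinimal] [NeZero (W.conductorNorm ℤ)] [NeZero (W'.conductorNorm ℤ)]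
    (u : VariableChange ℚ) (D : ModularParametrizationData W (W.conductorNorm ℤ))
    (D' : ModularParametrizationData W' (W'.conductorNorm ℤ))
    (hM : M ∣ W.conductorNorm ℤ) (hN : W'.conductorNorm ℤ = W.conductorNorm ℤ)
    (hu : u • W.quadraticTwist ((d : ℤ) : ℚ) = W') (hD : IsLatticeOptimal D) (hD' : IsLatticeOptimal D')
    (hΔ : W'.Δ = ((d : ℤ) : ℚ) ^ 6 * W.Δ) (hdeg : ¬ q ∣ D.modularDegree)
    (hε : cesnaviciusNeururerSahaCorrection (W.conductorNorm ℤ) q = 0) : ¬ (q : ℤ) ∣ D'.c := by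
  obtain ⟨hc, -⟩ := hE W W' u D D' hM hN hu hD hD' hΔ hdeg
  have hle : padicValInt q D.maninConstant ≤ padicValNat q D.modularDegree := by
    have := hCNS W D q hq
    rwa [hε, add_zero] at this
  have h2 : ¬ (q : ℤ) ∣ D.c := not_dvd_maninConstant_of_padicVal_le_of_not_dvd D hq hle hdeg
  rcases hc with h | h
  · rwa [h]
  · rw [h]; exact fun h3 ↦ h2 ((dvd_neg).mp h3)


/-! ## §6 (g3, v2) — the valuation form of E-an-15: ČNS with the twist PARTNER's degree

E-an-15 is the `v = 0` case of the bound below; on a commuting orbit with the bit decided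
(`deg D' = q · deg D`, E-an-16) it reads `v_q(c(D')) ≤ v_q(deg D') − 1 + ε_q(N)` — ČNS improved by one on
the non-twist-minimal member (the Kodaira-III* class at `9 ‖ N`). -/

/-- **E-an-15v `TwistPartnerDegreeBound d M`**: binders of E-an-15 without the two `p ∤ deg`, `ε = 0`
hypotheses; conclusion `v_p(c(D')) ≤ v_p(deg D) + ε_p(N)` (`D` ANY datum of the twist-minimal member `W`,
`D'` the lattice-optimal datum of the class of `W ⊗ χ_d`). Edge from E-an-9 ∧ ČNS below. -/
def TwistPartnerDegreeBound (d : ℤ) (M : ℕ) : Prop :=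
  ∀ (W W' C : WeierstrassCurve ℚ) [W.IsElliptic] [W.IsGloballyMinimal] [W'.IsElliptic]
    [W'.IsGloballyMinimal] [C.IsElliptic] [C.IsGloballyMinimal]
    [NeZero (W.conductorNorm ℤ)] [NeZero (W'.conductorNorm ℤ)] (u : VariableChange ℚ)
    (D : ModularParametrizationData W (W.conductorNorm ℤ))
    (D' : ModularParametrizationData W' (W'.conductorNorm ℤ)) (p : ℕ), p.Prime →
    M ∣ W.conductorNorm ℤ → W'.conductorNorm ℤ = W.conductorNorm ℤ →
    u • W.quadraticTwist ((d : ℤ) : ℚ) = C → WeierstrassCurve.IsIsogenous C W' →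
    IsLatticeOptimal D' → C.Δ = ((d : ℤ) : ℚ) ^ 6 * W.Δ →
    padicValInt p D'.c ≤
      padicValNat p D.modularDegree + cesnaviciusNeururerSahaCorrection (W.conductorNorm ℤ) p

/-- PROVED edge: E-an-9 (free direction) ∧ ČNS Thm 1.2 ⇒ E-an-15v. -/
theorem twistPartnerDegreeBound_of_transport (d : ℤ) (q M : ℕ)
    (hT : TwistOrbitManinTransport d q M) (hCNS : cesnaviciusNeururerSaha_thm_1_2) :
    TwistPartnerDegreeBound d M := by
  intro W W' C _ _ _ _ _ _ _ _ u D D' p hp hM hN hu hC hD' hΔ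
  haveI : Fact p.Prime := ⟨hp⟩
  have h1 : D'.c ∣ D.c := (hT W W' C u D D' hM hN hu hC hD').1 hΔ
  have hle : padicValInt p D'.c ≤ padicValInt p D.maninConstant :=
    Literature.Barriers.ABC.StewartTijdemanPrincipal.padicValInt_le_of_dvd h1 D.maninConstant_ne_zero_holds
  exact hle.trans (hCNS W D p hp)

/-- E-an-15v ⇒ E-an-15 (the `v = 0` case). -/
theorem twistMinimalDegreeRoadTransport_of_bound (d : ℤ) (M : ℕ) (hB : TwistPartnerDegreeBound d M) :
    TwistMinimalDegreeRoadTransport d M := by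
  intro W W' C _ _ _ _ _ _ _ _ u D D' p hp hM hN hu hC hD' hΔ hdeg hε
  haveI : Fact p.Prime := ⟨hp⟩
  have h := hB W W' C u D D' p hp hM hN hu hC hD' hΔ
  rw [hε, add_zero, padicValNat.eq_zero_of_not_dvd hdeg] at h
  intro hdvd
  have hpos : 0 < padicValInt p D'.c := by
    rcases (padicValInt_dvd_iff 1 D'.c).mp (by simpa using hdvd) with h0 | h0
    · exact absurd h0 D'.maninConstant_ne_zero_holds
    · exact_mod_cast h0
  omega


/-! ## §8 (g3 v5). The g2 edges instantiated: THM II (flip orbits) OUTRIGHT, THM III modulo Pal's dichotomy.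
Definitions E-an-11 `FlipOrbitManinEq`, S-an-11 `PalTwistDichotomy`, E-an-12 `OrbitManinDefectLeOne` and the two
edges are VERBATIM from HOME/an/Sketch-an3.lean 845c9227ccb9d3b8 (g2; ref1 C13 10/10 BC7 CLEAN); new are only the
`_pStar` corollaries fed by `twistOrbitManinTransport_pStar`. -/

section G2Edges

/-- **E-an-11 `FlipOrbitManinEq d q M` (THEOREM II; beyond print).** On an orbit where BOTH optimal curves are
twist-minimal (`Δ(C) = d⁶Δ(W)`, `Δ(C') = d⁶Δ(W')`; this forces the FLIP case and conversely holds on all but 2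
of the flips in the data) the Manin constants agree: `c(D') = ±c(D)` (E-an-9 both ways; PROVED edge below).
Census of flip orbits (both members (ũ,ũ) = (1,1)): d = −3: 21 770 ordered pairs; d = 2: 22 988; d = −2: 22 950;
q* = 5: 1 542, −7: 122, −11: 74 — the two remaining χ₋₃-flips (390150dc/gy, N > 4·10⁵) have (ũ,ũ) = (3,1). -/
def FlipOrbitManinEq (d : ℤ) (_q M : ℕ) : Prop :=
  ∀ (W W' C C' : WeierstrassCurve ℚ) [W.IsElliptic] [W.IsGloballyMinimal] [W'.IsElliptic]
    [W'.IsGloballyMinimal] [C.IsElliptic] [C.IsGloballyMinimal] [C'.IsElliptic] [C'.IsGloballyMinimal]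
    [NeZero (W.conductorNorm ℤ)] [NeZero (W'.conductorNorm ℤ)] (u u' : VariableChange ℚ)
    (D : ModularParametrizationData W (W.conductorNorm ℤ))
    (D' : ModularParametrizationData W' (W'.conductorNorm ℤ)),
    M ∣ W.conductorNorm ℤ → W'.conductorNorm ℤ = W.conductorNorm ℤ →
    u • W.quadraticTwist ((d : ℤ) : ℚ) = C → WeierstrassCurve.IsIsogenous C W' →
    u' • W'.quadraticTwist ((d : ℤ) : ℚ) = C' → WeierstrassCurve.IsIsogenous C' W →
    IsLatticeOptimal D → IsLatticeOptimal D' →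
    C.Δ = ((d : ℤ) : ℚ) ^ 6 * W.Δ → C'.Δ = ((d : ℤ) : ℚ) ^ 6 * W'.Δ →
    D'.c = D.c ∨ D'.c = -D.c

/-- **S-an-11 `PalTwistDichotomy d q M` (support; Literature fact candidate = Pal 2012 Prop. 2.5 / Connell 5.7,
statement-only).** At the same conductor with `M ∣ N` the minimal model `C` of `W ⊗ χ_d` has
`Δ(C) ∈ {d⁶Δ(W), d⁶Δ(W)/q¹²}` (`ũ ∈ {1,q}`; `ũ_ℓ = 1` off `q`).  Instances: `(q*,q,q²)` [Pal 2.5(1),(3)],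
`(−3,3,9)`, `(±2,2,2⁷)` [Connell (c): `f₂ ≥ 7` excludes `(0,0,·)`, `(6,9,≥18)`], `(−1,2,2⁵)` [S-an-10, then only
the first alternative].  Census: (v_pΔ(W), v_pΔ(C)) differ by exactly 6 in 100% of same-conductor pairs:
d = −3: 141 917 commuting + 10 885 flip orbits; d = ±2: 28 112 + 22 969; q* = 5, −7, −11, 13: 0 exceptions. -/
def PalTwistDichotomy (d : ℤ) (q M : ℕ) : Prop :=
  ∀ (W C : WeierstrassCurve ℚ) [W.IsElliptic] [W.IsGloballyMinimal] [C.IsElliptic]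
    [C.IsGloballyMinimal] (u : VariableChange ℚ),
    M ∣ W.conductorNorm ℤ → C.conductorNorm ℤ = W.conductorNorm ℤ →
    u • W.quadraticTwist ((d : ℤ) : ℚ) = C →
    C.Δ = ((d : ℤ) : ℚ) ^ 6 * W.Δ ∨ (q : ℚ) ^ 12 * C.Δ = ((d : ℤ) : ℚ) ^ 6 * W.Δ

/-- **E-an-12 `OrbitManinDefectLeOne d q M` (THEOREM III = relative Edixhoven-at-most-once at the wild primes;
beyond print; answers the cell's search question on same-level twist orbits).** On every same-conductor
`χ_d`-orbit of optimal curves: `c ∣ q·c′` and `c′ ∣ q·c` — so `|v_q c − v_q c′| ≤ 1` and `v_ℓ c = v_ℓ c′` for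
`ℓ ≠ q`; the controlling local invariant is Connell's scalar `ũ_q` (the `q`-adic signature `(v c₄, v c₆, v Δ)`),
the residual is ONE orbit bit (E-an-13).  PROVED edge below from E-an-9 + S-an-11.
Census: all 296 554 + 283 834 + 102 024 + 327 436 ordered pairs above: `12·|Δv_q c| ∈ {0, 12}` under `c = 1`
bookkeeping, ratio of degrees `∈ {1, q^{±1}}` in all but ONE pair (463834a1/b1, `N > 4·10⁵`, optimality code 2:
listed degrees 73 382 400 / 41 932 800 = 7/4 contradict E-an-14+S-an-13 — predicted: `deg(463834b1) = 10 483 200`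
or `deg(463834a1) = 293 529 600`; data ask D-an-5). -/
def OrbitManinDefectLeOne (d : ℤ) (q M : ℕ) : Prop :=
  ∀ (W W' C C' : WeierstrassCurve ℚ) [W.IsElliptic] [W.IsGloballyMinimal] [W'.IsElliptic]
    [W'.IsGloballyMinimal] [C.IsElliptic] [C.IsGloballyMinimal] [C'.IsElliptic] [C'.IsGloballyMinimal]
    [NeZero (W.conductorNorm ℤ)] [NeZero (W'.conductorNorm ℤ)] (u u' : VariableChange ℚ)
    (D : ModularParametrizationData W (W.conductorNorm ℤ))
    (D' : ModularParametrizationData W' (W'.conductorNorm ℤ)),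
    M ∣ W.conductorNorm ℤ → W'.conductorNorm ℤ = W.conductorNorm ℤ →
    u • W.quadraticTwist ((d : ℤ) : ℚ) = C → WeierstrassCurve.IsIsogenous C W' →
    C.conductorNorm ℤ = W.conductorNorm ℤ →
    u' • W'.quadraticTwist ((d : ℤ) : ℚ) = C' → WeierstrassCurve.IsIsogenous C' W →
    C'.conductorNorm ℤ = W'.conductorNorm ℤ →
    IsLatticeOptimal D → IsLatticeOptimal D' →
    D'.c ∣ (q : ℤ) * D.c ∧ D.c ∣ (q : ℤ) * D'.c

/-- E-an-9 (both ways) ⇒ E-an-11: on a doubly twist-minimal (flip) orbit the Manin constants agree up to sign. -/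
theorem flipOrbitManinEq_of_transport (d : ℤ) (q M : ℕ) (hT : TwistOrbitManinTransport d q M) :
    FlipOrbitManinEq d q M := by
  intro W W' C C' _ _ _ _ _ _ _ _ _ _ u u' D D' hM hN hu hC hu' hC' hD hD' hΔ hΔ'
  have h1 : D'.c ∣ D.c := (hT W W' C u D D' hM hN hu hC hD').1 hΔ
  have hM' : M ∣ W'.conductorNorm ℤ := hN ▸ hM
  have h2 : D.c ∣ D'.c := (hT W' W C' u' D' D hM' hN.symm hu' hC' hD).1 hΔ'
  have h3 : D'.c.natAbs = D.c.natAbs :=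
    Nat.dvd_antisymm (Int.natAbs_dvd_natAbs.2 h1) (Int.natAbs_dvd_natAbs.2 h2)
  exact Int.natAbs_eq_natAbs_iff.1 h3

/-- E-an-9 + S-an-11 (both ways) ⇒ E-an-12: `c′ ∣ q c` and `c ∣ q c′` on every same-conductor orbit. -/
theorem orbitManinDefectLeOne_of_transport (d : ℤ) (q M : ℕ) (hT : TwistOrbitManinTransport d q M)
    (hP : PalTwistDichotomy d q M) : OrbitManinDefectLeOne d q M := by
  intro W W' C C' _ _ _ _ _ _ _ _ _ _ u u' D D' hM hN hu hC hCN hu' hC' hC'N hD hD'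
  have hM' : M ∣ W'.conductorNorm ℤ := hN ▸ hM
  obtain ⟨hA, hB⟩ := hT W W' C u D D' hM hN hu hC hD'
  obtain ⟨hA', hB'⟩ := hT W' W C' u' D' D hM' hN.symm hu' hC' hD
  refine ⟨?_, ?_⟩
  · rcases hP W C u hM hCN hu with h | h
    · exact Dvd.dvd.mul_left (hA h) _
    · exact hB h
  · rcases hP W' C' u' hM' hC'N hu' with h | h
    · exact Dvd.dvd.mul_left (hA' h) _
    · exact hB' h


end G2Edges

end Summit.BirchSwinnertonDyer.Rank1Residual.ManinAdditive

end
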